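import Summits.RiemannHypothesis.RiemannHypothesis.Theorems.HandoffDodgerSmallWindow
import Summits.RiemannHypothesis.RiemannHypothesis.Theorems.HandoffDodgerSlabSixHorizon
import HarnessLib

/-!
# HANDOFF — SIXTH SLAB (3): the window conditions at `y = 16` on `640 ≤ q < 1015` (rh-explicit, W-P(P2) crux 19172 residue, seat prove-2 gen14; ATTEMPT-24 §3)

RH-FREE. HONEST FRAMING: nothing here bears on the truth of RH; part (3) of the discharge of the hypotheses of
`HandoffDodgerExplicitWindowCountingFT.dodger_witness_explicit_window_counting_ft` on the sixth slab `640 ≤ q < 1015` at the constant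
schedule `y = 16`: the radius facts (`639 ≤ e^{2b} ≤ 1014`, `2b ≤ L ≤ 2b + 1/100`), `0 ≤ δU ≤ 1/1250`, `δU ≤ b`, `600r ≤ δL`, the rate
`δU ≤ (1/5)(log q)^{3/2}q^{−3/2}`, the window `(log q)/2 + δU ≤ (log q′)/2` for every `q′ ≥ q + 1`, and `√q ≤ 1.0001·e^b`.
dodger-p2's `HandoffDodgerSlabFiveWindow` re-constanted (`T ≥ 16.8e^{2b}` in place of `T₀ ≤ 1.01T`).

References: this track (ATTEMPT-16 §1, ATTEMPT-21 §4, ATTEMPT-23 §2/§7, ATTEMPT-24 §3; HOME/rh-explicit-dodger-p2/DODGER-STAGE2-PLAN.md §2).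
-/

set_option linter.dupNamespace false

noncomputable section

open Real

namespace Summit.RiemannHypothesis.RiemannHypothesis.Theorems.Handoff

/-- `6.44 ≤ log q` for `q ≥ 640`. [folklore] -/
theorem log_ge_of_ge_six_hundred_forty {q : ℕ} (hq : 640 ≤ q) : 6.44 ≤ Real.log q := by
  have hq0 : (0 : ℝ) < q := by exact_mod_cast (by omega : 0 < q)
  rw [Real.le_log_iff_exp_le hq0]
  have hq' : (640 : ℝ) ≤ q := by exact_mod_cast hq
  have h := exp_slabSix_bounds.1
  norm_num at h ⊢
  linarith

/-- The mollifier radius on the sixth slab `640 ≤ q < 1015`: `0 < r ≤ 4·10⁻⁹`, `rq³ ≤ 1`, `6.44 ≤ L`, `q = e^L`,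
`639 ≤ e^{2b} ≤ 1014`, `2b ≤ L ≤ 2b + 1/100`, `r ≤ 10⁻⁸`. [this track, ATTEMPT-23 §7; ATTEMPT-24 §3] -/
theorem radius_facts_slabSix {q : ℕ} {L b r : ℝ} (hq : 640 ≤ q) (hq' : q < 1015) (hL : L = Real.log q)
    (hr : r = 1 / ((q : ℝ) ^ 3 + 1)) (hbq1 : b + r ≤ L / 2) (hbq2 : L / 2 ≤ b + 2 * r) :
    0 < r ∧ r ≤ 1 / (25 * 10 ^ 7) ∧ r * (q : ℝ) ^ 3 ≤ 1 ∧ 6.44 ≤ L ∧ (q : ℝ) = Real.exp L ∧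
      639 ≤ Real.exp (2 * b) ∧ Real.exp (2 * b) ≤ 1014 ∧
      2 * b ≤ L ∧ L ≤ 2 * b + 1 / 100 ∧ r ≤ 1 / 10 ^ 8 := by
  have hq0 : (0 : ℝ) < q := by exact_mod_cast (by omega : 0 < q)
  have hqL : (q : ℝ) = Real.exp L := by rw [hL, Real.exp_log hq0]
  have hr0 : 0 < r := by rw [hr]; positivity
  have hL10 : 6.44 ≤ L := by rw [hL]; exact log_ge_of_ge_six_hundred_forty hq
  have hqge : (640 : ℝ) ≤ q := by exact_mod_cast hq
  have hqlt : (q : ℝ) ≤ 1014 := by exact_mod_cast (by omega : q ≤ 1014)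
  have hq3 : (640 : ℝ) ^ 3 ≤ (q : ℝ) ^ 3 := pow_le_pow_left₀ (by norm_num) hqge 3
  have hr13 : r ≤ 1 / (25 * 10 ^ 7) := by
    rw [hr]; apply div_le_div_of_nonneg_left (by norm_num) (by norm_num); nlinarith
  have hrq : r * (q : ℝ) ^ 3 ≤ 1 := by
    rw [hr, div_mul_eq_mul_div, one_mul, div_le_one (by positivity)]; linarith
  have hr8 : r ≤ 1 / 10 ^ 8 := hr13.trans (by norm_num)
  -- `e^{2b} ≤ e^L = q ≤ 1014` and `e^{2b} ≥ e^{L − 4r} ≥ q(1 − 4r) ≥ 639`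
  have hup : Real.exp (2 * b) ≤ 1014 := by
    have : Real.exp (2 * b) ≤ Real.exp L := Real.exp_le_exp.2 (by linarith)
    linarith
  have hlo : 639 ≤ Real.exp (2 * b) := by
    have h1 : Real.exp (L - 4 * r) ≤ Real.exp (2 * b) := Real.exp_le_exp.2 (by linarith)
    have h2 : Real.exp (L - 4 * r) = q * Real.exp (-(4 * r)) := by rw [sub_eq_add_neg, Real.exp_add, hqL]
    have h3 : 1 - 4 * r ≤ Real.exp (-(4 * r)) := by have := Real.add_one_le_exp (-(4 * r)); linarith
    have h4 : (q : ℝ) * (1 - 4 * r) ≤ q * Real.exp (-(4 * r)) := mul_le_mul_of_nonneg_left h3 hq0.le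
    have h5 : (q : ℝ) * (4 * r) ≤ 1 := by nlinarith
    nlinarith
  exact ⟨hr0, hr13, hrq, hL10, hqL, hlo, hup, by linarith, by linarith, hr8⟩

/-- `600r ≤ δL = 16/√pU` on the sixth slab. [this track, ATTEMPT-23 §7; ATTEMPT-24 §3] -/
theorem radius_le_deltaL_slabSix {q : ℕ} {r T pU y : ℝ} (hr0 : 0 < r) (hr13 : r ≤ 1 / (25 * 10 ^ 7)) (hrq : r * (q : ℝ) ^ 3 ≤ 1)
    (hq0 : (0 : ℝ) < q) (hT0 : 0 < T) (hTq1 : T ≤ 17.1 * q) (hpU0 : 0 < pU)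
    (hpU : pU ≤ 1.106 * T ^ 3) (hy : y = 16) :
    600 * r ≤ y / Real.sqrt pU := by
  have hy0 : 0 ≤ y := by rw [hy]; norm_num
  have e : y / Real.sqrt pU = Real.sqrt (y ^ 2 / pU) := by rw [Real.sqrt_div (sq_nonneg y), Real.sqrt_sq hy0]
  rw [e, Real.le_sqrt (by linarith) (by positivity), le_div_iff₀ hpU0, hy]
  have h1 : T ^ 3 ≤ (17.1 * q) ^ 3 := pow_le_pow_left₀ hT0.le hTq1 3
  have h2 : (600 * r) ^ 2 * pU ≤ (600 * r) ^ 2 * (1.106 * (17.1 * q) ^ 3) := by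
    apply mul_le_mul_of_nonneg_left _ (by positivity); nlinarith only [hpU, h1]
  have h3 : (600 * r) ^ 2 * (1.106 * (17.1 * (q : ℝ)) ^ 3) ≤ 8 := by
    have : (600 * r) ^ 2 * (1.106 * (17.1 * (q : ℝ)) ^ 3) = 360000 * 1.106 * 17.1 ^ 3 * (r * (r * (q : ℝ) ^ 3)) := by ring
    rw [this]
    have h4 : r * (r * (q : ℝ) ^ 3) ≤ 1 / (25 * 10 ^ 7) * 1 := mul_le_mul hr13 hrq (by positivity) (by norm_num)
    nlinarith only [h4]
  nlinarith only [h2, h3]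

/-- The rate bound `δU = 16/√pL ≤ (1/5)·L√L/(q√q)` on the sixth slab (`L ≥ 6.44`, `16.79q ≤ T`, `pL ≥ T³/30.1`). [this track, ATTEMPT-23 §7; ATTEMPT-24 §3] -/
theorem deltaU_rate_slabSix {q : ℕ} {L T pL : ℝ} (hq0 : (0 : ℝ) < q) (hL : 6.44 ≤ L) (hTq2 : 16.79 * q ≤ T)
    (hpL : T ^ 3 / 30.1 ≤ pL) :
    16 / Real.sqrt pL ≤ 1 / 5 * (L * Real.sqrt L) / ((q : ℝ) * Real.sqrt q) := by
  have hL0 : 0 < L := by linarith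
  have hpLq : (12.5 : ℝ) ^ 2 * (q : ℝ) ^ 3 ≤ pL := by
    have h1 : (16.79 * q) ^ 3 ≤ T ^ 3 := pow_le_pow_left₀ (by positivity) hTq2 3
    have h4 : T ^ 3 ≤ 30.1 * pL := by rw [div_le_iff₀ (by norm_num)] at hpL; linarith
    nlinarith [pow_pos hq0 3]
  have hpL0 : 0 < pL := lt_of_lt_of_le (by positivity) hpLq
  rw [div_le_div_iff₀ (Real.sqrt_pos.2 hpL0) (by positivity)]
  have hs : 12.5 * ((q : ℝ) * Real.sqrt q) ≤ Real.sqrt pL := by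
    rw [Real.le_sqrt (by positivity) hpL0.le, mul_pow, mul_pow, Real.sq_sqrt hq0.le]
    nlinarith
  have hsL : 2.53 ≤ Real.sqrt L := by
    rw [Real.le_sqrt (by norm_num) hL0.le]; nlinarith
  have hLL : 16.29 ≤ L * Real.sqrt L := by nlinarith
  have hqq : 0 ≤ (q : ℝ) * Real.sqrt q := by positivity
  nlinarith [mul_le_mul hLL hs (by positivity) (by positivity), mul_nonneg hqq (Real.sqrt_nonneg pL)]

/-- The window bound `(1/5)·L√L/(q√q) ≤ 1/(2(q+1))` for `q = e^L ≥ 640`, `L ≥ 6`. [this track, ATTEMPT-23 §7] -/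
theorem rate_le_half_inv_slabSix {q : ℕ} {L : ℝ} (hqL : (q : ℝ) = Real.exp L) (hq : 640 ≤ q) (hL10 : 6 ≤ L) :
    1 / 5 * (L * Real.sqrt L) / ((q : ℝ) * Real.sqrt q) ≤ 1 / (2 * ((q : ℝ) + 1)) := by
  have hL0 : 0 < L := by linarith
  have hq0 : (0 : ℝ) < q := by exact_mod_cast (by omega : 0 < q)
  have hq' : (640 : ℝ) ≤ q := by exact_mod_cast hq
  rw [div_le_div_iff₀ (by positivity) (by positivity)]
  have hsq : 0.405 * (L * Real.sqrt L) ≤ Real.sqrt q := by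
    rw [Real.le_sqrt (by positivity) hq0.le, mul_pow, mul_pow, Real.sq_sqrt hL0.le]
    have h3 : L ^ 3 / 6 ≤ Real.exp L := by
      have := Real.pow_div_factorial_le_exp L hL0.le 3
      norm_num [Nat.factorial] at this; exact this
    rw [← hqL] at h3
    nlinarith [pow_pos hL0 3]
  have hLL : 0 ≤ L * Real.sqrt L := by positivity
  nlinarith [mul_le_mul_of_nonneg_left hsq hq0.le, Real.sqrt_nonneg (q : ℝ), mul_nonneg hLL (Real.sqrt_nonneg (q : ℝ)),
    mul_le_mul_of_nonneg_left hq' hLL]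

/-- **Part (3) of the sixth-slab discharge: the window conditions at `y = 16` for `640 ≤ q < 1015`.**
[this track, ATTEMPT-23 §7; ATTEMPT-24 §3] -/
theorem window_conditions_slabSix {q : ℕ} {L b r T pL pU y δU δL : ℝ} (hq : 640 ≤ q) (hq' : q < 1015)
    (hL : L = Real.log q) (hr : r = 1 / ((q : ℝ) ^ 3 + 1)) (hbq1 : b + r ≤ L / 2) (hbq2 : L / 2 ≤ b + 2 * r)
    (hTT₀ : T ≤ 2 * π * Real.exp (1 + 2 * b)) (hTe : 16.8 * Real.exp (2 * b) ≤ T)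
    (hpL : T ^ 3 / 30.1 ≤ pL) (hpU0 : 0 < pU) (hpU : pU ≤ 1.106 * T ^ 3) (hy : y = 16)
    (hδU : δU = y / Real.sqrt pL) (hδL : δL = y / Real.sqrt pU) :
    (639 ≤ Real.exp (2 * b) ∧ Real.exp (2 * b) ≤ 1014 ∧ 2 * b ≤ L ∧ L ≤ 2 * b + 1 / 100) ∧
      (0 ≤ δU ∧ δU ≤ 1 / 1250 ∧ δU ≤ b) ∧ (600 * r ≤ δL ∧ 6 * r ≤ δL) ∧
      δU ≤ 1 / 5 * Real.log q ^ (3 / 2 : ℝ) * (q : ℝ) ^ (-(3 / 2 : ℝ)) ∧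
      (∀ q' : ℕ, q + 1 ≤ q' → Real.log q / 2 + δU ≤ Real.log q' / 2) ∧
      (0 < Real.sqrt q ∧ Real.sqrt q ≤ 1.0001 * Real.exp b) := by
  have hq0 : (0 : ℝ) < q := by exact_mod_cast (by omega : 0 < q)
  obtain ⟨hr0, hr13, hrq, hL10, hqL, he, he', hL1, hL2, hr8⟩ := radius_facts_slabSix hq hq' hL hr hbq1 hbq2
  obtain ⟨hb0, hb1⟩ := slabSix_b_bounds he he'
  -- `T ≤ 17.1q` and `16.79q ≤ T` (`e^{2b} ≤ e^L = q`, `e^{2b} ≥ q(1 − 4r)`, `2πe ≤ 17.08`, `T ≥ 16.8e^{2b}`)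
  have hE1 : Real.exp (2 * b) ≤ q := by rw [hqL]; exact Real.exp_le_exp.2 (by linarith)
  have hE2 : (q : ℝ) * (1 - 4 * r) ≤ Real.exp (2 * b) := by
    have h1 : Real.exp (L - 4 * r) ≤ Real.exp (2 * b) := Real.exp_le_exp.2 (by linarith)
    have h2 : Real.exp (L - 4 * r) = q * Real.exp (-(4 * r)) := by rw [sub_eq_add_neg, Real.exp_add, hqL]
    have h3 : 1 - 4 * r ≤ Real.exp (-(4 * r)) := by have := Real.add_one_le_exp (-(4 * r)); linarith
    have h4 : (q : ℝ) * (1 - 4 * r) ≤ q * Real.exp (-(4 * r)) := mul_le_mul_of_nonneg_left h3 hq0.le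
    linarith
  have hTq1 : T ≤ 17.1 * q := by
    have hπ4 : π < 3.1416 := Real.pi_lt_d4
    have hel := Real.exp_one_lt_d9
    have e1 : 2 * π * Real.exp (1 + 2 * b) = 2 * π * Real.exp 1 * Real.exp (2 * b) := by rw [Real.exp_add]; ring
    have h2πe : 2 * π * Real.exp 1 ≤ 17.08 := by nlinarith only [hπ4, hel, Real.exp_pos 1, Real.pi_pos]
    have h3 := mul_le_mul h2πe hE1 (Real.exp_pos _).le (by norm_num)
    rw [e1] at hTT₀
    linarith
  have hTq2 : 16.79 * q ≤ T := by
    have hqr : (q : ℝ) * r ≤ 1 / 10 ^ 5 := by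
      have hqle : (q : ℝ) ≤ 1014 := by exact_mod_cast (by omega : q ≤ 1014)
      nlinarith
    nlinarith
  have hL0 : 0 < L := by linarith
  have hT0 : 0 < T := by nlinarith
  have hpL0 : 0 < pL := lt_of_lt_of_le (by positivity) hpL
  have hy0 : 0 ≤ y := by rw [hy]; norm_num
  have hδU0 : 0 ≤ δU := by rw [hδU]; positivity
  have hδL600 : 600 * r ≤ δL := by
    rw [hδL]; exact radius_le_deltaL_slabSix hr0 hr13 hrq hq0 hT0 hTq1 hpU0 hpU hy
  have hδL6 : 6 * r ≤ δL := by linarith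
  have hrate : δU ≤ 1 / 5 * (L * Real.sqrt L) / ((q : ℝ) * Real.sqrt q) := by
    rw [hδU, hy]; exact deltaU_rate_slabSix hq0 hL10 hTq2 hpL
  have h3 : δU ≤ 1 / (2 * ((q : ℝ) + 1)) := hrate.trans (rate_le_half_inv_slabSix hqL hq (by linarith))
  have hδU1 : δU ≤ 1 / 1250 := by
    have hq'' : (640 : ℝ) ≤ q := by exact_mod_cast hq
    have h4 : 1 / (2 * ((q : ℝ) + 1)) ≤ 1 / 1250 := div_le_div_of_nonneg_left (by norm_num) (by norm_num) (by linarith)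
    linarith
  have rpow32 : ∀ x : ℝ, 0 ≤ x → x ^ (3 / 2 : ℝ) = x * Real.sqrt x := fun x hx => by
    rw [show (3 / 2 : ℝ) = 1 + 1 / 2 by norm_num, Real.rpow_add' hx (by norm_num), Real.rpow_one, Real.sqrt_eq_rpow]
  have hrate' : δU ≤ 1 / 5 * Real.log q ^ (3 / 2 : ℝ) * (q : ℝ) ^ (-(3 / 2 : ℝ)) := by
    rw [← hL, Real.rpow_neg hq0.le, rpow32 _ hL0.le, rpow32 _ hq0.le, ← div_eq_mul_inv]
    exact hrate
  have hwin : ∀ q' : ℕ, q + 1 ≤ q' → Real.log q / 2 + δU ≤ Real.log q' / 2 := by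
    intro q' hq'
    have hq'0 : (q : ℝ) + 1 ≤ q' := by exact_mod_cast hq'
    have h1 : Real.log ((q : ℝ) + 1) ≤ Real.log q' := Real.log_le_log (by positivity) hq'0
    have h2 : 1 / ((q : ℝ) + 1) ≤ Real.log ((q : ℝ) + 1) - Real.log q := by
      have := Real.one_sub_inv_le_log_of_pos (show 0 < ((q : ℝ) + 1) / q by positivity)
      rw [Real.log_div (by positivity) hq0.ne', inv_div] at this
      have e : 1 - (q : ℝ) / (q + 1) = 1 / (q + 1) := by field_simp; ring
      linarith
    have h4 : 1 / (2 * ((q : ℝ) + 1)) * 2 = 1 / ((q : ℝ) + 1) := by field_simp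
    rw [← hL] at h2 ⊢
    linarith
  have hsq : Real.sqrt q = Real.exp (L / 2) := by
    rw [hqL, show Real.exp L = Real.exp (L / 2) ^ 2 by rw [← Real.exp_nat_mul]; ring_nf,
      Real.sqrt_sq (Real.exp_pos _).le]
  have hsq1 : Real.sqrt q ≤ 1.0001 * Real.exp b := by
    rw [hsq]
    have h1 : Real.exp (L / 2) ≤ Real.exp (b + 2 * r) := Real.exp_le_exp.2 hbq2
    rw [Real.exp_add] at h1
    have h2 : Real.exp (2 * r) ≤ 1 + 2 * (2 * r) := by
      have h2r : 0 ≤ 2 * r := by linarith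
      have := Real.abs_exp_sub_one_le (x := 2 * r) (by rw [abs_of_nonneg h2r]; linarith)
      rw [abs_of_nonneg h2r] at this
      have := (abs_le.1 this).2
      linarith
    have h3 : Real.exp b * Real.exp (2 * r) ≤ Real.exp b * 1.0001 :=
      mul_le_mul_of_nonneg_left (by linarith) (Real.exp_pos b).le
    linarith
  exact ⟨⟨he, he', hL1, hL2⟩, ⟨hδU0, hδU1, by linarith⟩, ⟨hδL600, hδL6⟩, hrate', hwin, ⟨Real.sqrt_pos.2 hq0, hsq1⟩⟩

end Summit.RiemannHypothesis.RiemannHypothesis.Theorems.Handoff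

end
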